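import Summits.RiemannHypothesis.RiemannHypothesis.Theorems.SpectralTraceWindowStepConjugateSplit
import HarnessLib

/-!
# The conjugate-point dichotomy is a genuine PARTITION of the failure worlds (calibration)

Crux `stmt-RiemannHypothesis-14659` (`SpectralTrace.WindowStep`), line `conjugate-point`, split glue
`Theorems/SpectralTraceWindowStepConjugateSplit.lean` (`windowStep_of_dichotomy`,
`windowStep_iff_dichotomy`).

Two kernel-checked facts the planners use when filing the split
`WindowStep ⟸ CrystRegular ∧ NoDegenerateEdge`:

* `exists_max_trace_level` (RH-FREE): the set of positive window levels carrying a real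
  unit-multiplicity trace family is an initial CLOSED segment of `(0, ∞)` — if some level `A₀ > 0`
  fails, there is `M ∈ [0, A₀)` with `Trace A ↔ A ≤ M` for every `A > 0` (antitonicity
  `windowTrace_anti` + the landed closedness under suprema `traceClosed`). So in any world where the
  ladder dies it dies at a MAXIMAL level `A‡ = M`.
* `dichotomy_failure_located`: in a hypothetical world with the seed `WindowTraceArch` and `¬RH`
  (the only way the crux can fail, `not_windowStep_iff`), EXACTLY ONE child fails, and which one is
  decided by the sign of `ε(A‡/2) ≥ 0`: if `ε(A‡/2) > 0` (the ladder dies with spectral slack) then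
  `CrystRegular` fails and `NoDegenerateEdge` holds; if `ε(A‡/2) = 0` (it dies exactly at the conjugate
  level) then `CrystRegular` holds and `NoDegenerateEdge` fails. Neither child is `≡ (Arch → RH)`
  unless the other is a theorem.
-/

set_option linter.dupNamespace false

noncomputable section

open Complex Set Filter
open scoped Topology

namespace Summit.RiemannHypothesis.RiemannHypothesis.Theorems.SpectralTraceWindowStep

open Literature.NumberTheory.LFunctions
open Summit.RiemannHypothesis.RiemannHypothesis.Theses.SpectralTrace
open Summit.RiemannHypothesis.RiemannHypothesis.Theorems
open Summit.RiemannHypothesis.RiemannHypothesis.Theorems.WindowStep.Negative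
open Summit.RiemannHypothesis.RiemannHypothesis.Theorems.WeilWindowFlowGronwallLeakage

/-- `Trace(A)` (file-local notation, verbatim the shape of `WindowTraceArch` / `WindowStep`). -/
local notation3 "WTrace " A:max => ∃ (ι : Type) (γ : ι → ℝ), ∀ g : ℝ → ℂ, IsWeilTest g →
  tsupport g ⊆ Set.Icc (-A) A →
    HasSum (fun i => weilMellin g (1 / 2 + (γ i : ℂ) * I)) (weilFunctional g)

/-! ## RH-free: the trace levels form an initial closed segment -/

/-- **The ladder dies at a maximum (RH-free).** If some positive level `A₀` carries no trace family,
there is `M ∈ [0, A₀)` such that, for every `A > 0`, level `A` carries a trace family iff `A ≤ M`.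
(`M = sup` of the trace levels, a rung itself by `traceClosed`; `M = 0` if there is none.)
[folklore] -/
theorem exists_max_trace_level :
    ∀ A₀ : ℝ, 0 < A₀ →
      (¬ ∃ (ι : Type) (γ : ι → ℝ), ∀ g : ℝ → ℂ, Literature.NumberTheory.LFunctions.IsWeilTest g →
          tsupport g ⊆ Set.Icc (-A₀) A₀ →
            HasSum (fun i => Literature.NumberTheory.LFunctions.weilMellin g (1 / 2 + (γ i : ℂ) * Complex.I))
              (Literature.NumberTheory.LFunctions.weilFunctional g)) →
      ∃ M : ℝ, 0 ≤ M ∧ M < A₀ ∧ ∀ A : ℝ, 0 < A →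
        ((∃ (ι : Type) (γ : ι → ℝ), ∀ g : ℝ → ℂ, Literature.NumberTheory.LFunctions.IsWeilTest g →
            tsupport g ⊆ Set.Icc (-A) A →
              HasSum (fun i => Literature.NumberTheory.LFunctions.weilMellin g (1 / 2 + (γ i : ℂ) * Complex.I))
                (Literature.NumberTheory.LFunctions.weilFunctional g)) ↔ A ≤ M) := by
  intro A₀ hA₀ hfail
  set S : Set ℝ := {A : ℝ | 0 < A ∧ WTrace A} with hS
  -- every trace level lies strictly below the failing level
  have hlt : ∀ A ∈ S, A < A₀ := by
    intro A hA
    by_contra h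
    exact hfail (windowTrace_anti (le_of_not_gt h) hA.2)
  have hbdd : BddAbove S := ⟨A₀, fun A hA => (hlt A hA).le⟩
  by_cases hne : S.Nonempty
  · set M : ℝ := sSup S with hM
    have hMle : M ≤ A₀ := csSup_le hne fun A hA => (hlt A hA).le
    have hMpos : 0 < M := by
      obtain ⟨A₁, hA₁⟩ := hne
      exact hA₁.1.trans_le (le_csSup hbdd hA₁)
    -- levels strictly below `M` are rungs
    have hbelow : ∀ B : ℝ, 0 < B → B < M → WTrace B := by
      intro B _ hBM
      obtain ⟨A, hA, hBA⟩ := exists_lt_of_lt_csSup hne hBM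
      exact windowTrace_anti hBA.le hA.2
    -- hence `M` itself is a rung (closedness under suprema, RH-free)
    have hMtrace : WTrace M := traceClosed M hMpos hbelow
    have hMlt : M < A₀ := by
      rcases hMle.lt_or_eq with h | h
      · exact h
      · exfalso
        rw [h] at hMtrace
        exact hfail hMtrace
    refine ⟨M, hMpos.le, hMlt, fun A hA => ⟨fun h => le_csSup hbdd ⟨hA, h⟩, fun h => ?_⟩⟩
    rcases h.lt_or_eq with h' | h'
    · exact hbelow A hA h'
    · rw [h']
      exact hMtrace
  · refine ⟨0, le_rfl, hA₀, fun A hA => ⟨fun h => ?_, fun h => ?_⟩⟩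
    · exact absurd ⟨A, hA, h⟩ hne
    · exact absurd hA (not_lt.2 h)

/-! ## Exactly one child fails in a seed-and-not-RH world, and where -/

/-- **The cut is a partition of the failure worlds.** Assume the seed `WindowTraceArch` and `¬RH`
(equivalently `¬WindowStep`, `not_windowStep_iff`). Then there is a maximal trace level
`M = A‡ ≥ log 2` (`Trace A ↔ A ≤ M` for all `A > 0`), `ε(M/2) ≥ 0`, and EXACTLY ONE child of the
split fails, decided by the sign of `ε(M/2)`: interior death `0 < ε(M/2)` — `CrystRegular` fails (a
regular level just above `M`, by continuity of `ε`) while `NoDegenerateEdge` holds (below `M` every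
half level is strictly regular by antitonicity); edge death `ε(M/2) = 0` — `CrystRegular` holds
(regular half levels lie below `M/2` by strict antitonicity) while `NoDegenerateEdge` fails at
`a = M/2 ≥ log 3 / 2`. [folklore] -/
theorem dichotomy_failure_located :
    Summit.RiemannHypothesis.RiemannHypothesis.Theses.SpectralTrace.WindowTraceArch → ¬ RiemannHypothesis →
      ∃ M : ℝ, Real.log 2 ≤ M ∧
        (∀ A : ℝ, 0 < A →
          ((∃ (ι : Type) (γ : ι → ℝ), ∀ g : ℝ → ℂ, Literature.NumberTheory.LFunctions.IsWeilTest g →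
              tsupport g ⊆ Set.Icc (-A) A →
                HasSum (fun i => Literature.NumberTheory.LFunctions.weilMellin g (1 / 2 + (γ i : ℂ) * Complex.I))
                  (Literature.NumberTheory.LFunctions.weilFunctional g)) ↔ A ≤ M)) ∧
        0 ≤ Literature.NumberTheory.LFunctions.weilGroundEnergy (M / 2) ∧
        ((0 < Literature.NumberTheory.LFunctions.weilGroundEnergy (M / 2) ∧
            ¬ (∀ B : ℝ, Real.log 2 ≤ B →
                Summit.RiemannHypothesis.RiemannHypothesis.Theses.SpectralTrace.WindowTraceArch →
                  0 < Literature.NumberTheory.LFunctions.weilGroundEnergy (B / 2) →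
                    ∃ (ι : Type) (γ : ι → ℝ), ∀ g : ℝ → ℂ, Literature.NumberTheory.LFunctions.IsWeilTest g →
                      tsupport g ⊆ Set.Icc (-B) B →
                        HasSum (fun i => Literature.NumberTheory.LFunctions.weilMellin g (1 / 2 + (γ i : ℂ) * Complex.I))
                          (Literature.NumberTheory.LFunctions.weilFunctional g)) ∧
            (∀ a : ℝ, Real.log 3 / 2 ≤ a →
              (∀ B : ℝ, 0 < B → B < 2 * a →
                ∃ (ι : Type) (γ : ι → ℝ), ∀ g : ℝ → ℂ, Literature.NumberTheory.LFunctions.IsWeilTest g →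
                  tsupport g ⊆ Set.Icc (-B) B →
                    HasSum (fun i => Literature.NumberTheory.LFunctions.weilMellin g (1 / 2 + (γ i : ℂ) * Complex.I))
                      (Literature.NumberTheory.LFunctions.weilFunctional g)) →
              0 < Literature.NumberTheory.LFunctions.weilGroundEnergy a)) ∨
          (Literature.NumberTheory.LFunctions.weilGroundEnergy (M / 2) = 0 ∧
            (∀ B : ℝ, Real.log 2 ≤ B →
                Summit.RiemannHypothesis.RiemannHypothesis.Theses.SpectralTrace.WindowTraceArch →
                  0 < Literature.NumberTheory.LFunctions.weilGroundEnergy (B / 2) →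
                    ∃ (ι : Type) (γ : ι → ℝ), ∀ g : ℝ → ℂ, Literature.NumberTheory.LFunctions.IsWeilTest g →
                      tsupport g ⊆ Set.Icc (-B) B →
                        HasSum (fun i => Literature.NumberTheory.LFunctions.weilMellin g (1 / 2 + (γ i : ℂ) * Complex.I))
                          (Literature.NumberTheory.LFunctions.weilFunctional g)) ∧
            ¬ (∀ a : ℝ, Real.log 3 / 2 ≤ a →
              (∀ B : ℝ, 0 < B → B < 2 * a →
                ∃ (ι : Type) (γ : ι → ℝ), ∀ g : ℝ → ℂ, Literature.NumberTheory.LFunctions.IsWeilTest g →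
                  tsupport g ⊆ Set.Icc (-B) B →
                    HasSum (fun i => Literature.NumberTheory.LFunctions.weilMellin g (1 / 2 + (γ i : ℂ) * Complex.I))
                      (Literature.NumberTheory.LFunctions.weilFunctional g)) →
              0 < Literature.NumberTheory.LFunctions.weilGroundEnergy a))) := by
  intro hArch hnRH
  have hlog2 : 0 < Real.log 2 := Real.log_pos one_lt_two
  -- the crux fails: some rung `n ≥ 2` without the next one
  have hnot : ¬ WindowStep := not_windowStep_iff.2 ⟨hArch, hnRH⟩
  obtain ⟨n, hn, hrung, hfail⟩ : ∃ n : ℕ, 2 ≤ n ∧ WTrace (Real.log (n : ℝ)) ∧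
      ¬ WTrace (Real.log ((n : ℝ) + 1)) := by
    by_contra h
    exact hnot fun n hn hr => by_contra fun hf => h ⟨n, hn, hr, hf⟩
  have hn' : (2 : ℝ) ≤ n := by exact_mod_cast hn
  have hA₀ : 0 < Real.log ((n : ℝ) + 1) := Real.log_pos (by linarith)
  obtain ⟨M, -, -, hM⟩ := exists_max_trace_level _ hA₀ hfail
  -- `log 2 ≤ log n ≤ M`
  have hlogn : 0 < Real.log (n : ℝ) := Real.log_pos (by linarith)
  have h2M : Real.log 2 ≤ M :=
    (Real.log_le_log two_pos hn').trans ((hM _ hlogn).1 hrung)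
  have hMpos : 0 < M := hlog2.trans_le h2M
  have hMtrace : WTrace M := (hM M hMpos).2 le_rfl
  -- `ε(M/2) ≥ 0` from the rung at `M`
  have hε0 : 0 ≤ weilGroundEnergy (M / 2) := by
    have h2 : WTrace (2 * (M / 2)) := by rwa [show 2 * (M / 2) = M by ring]
    exact weilGroundEnergy_nonneg_of_wtrace' (by positivity) h2
  refine ⟨M, h2M, hM, hε0, ?_⟩
  rcases hε0.lt_or_eq with hpos | h0
  · -- interior death: `CrystRegular` fails, `NoDegenerateEdge` holds
    refine Or.inl ⟨hpos, fun hR => ?_, fun a _ hbelow => ?_⟩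
    · -- a regular level just above `M`
      have hcont : ContinuousAt weilGroundEnergy (M / 2) := continuousAt_weilGroundEnergy (by positivity)
      have hev : ∀ᶠ x in 𝓝 (M / 2), 0 < weilGroundEnergy x := hcont.eventually (lt_mem_nhds hpos)
      obtain ⟨η, hη, hball⟩ := Metric.eventually_nhds_iff.1 hev
      have hy : 0 < weilGroundEnergy (M / 2 + η / 2) := by
        refine hball ?_
        rw [Real.dist_eq, show M / 2 + η / 2 - M / 2 = η / 2 by ring, abs_of_pos (half_pos hη)]
        linarith
      have hB : Real.log 2 ≤ M + η := by linarith
      have hT : WTrace (M + η) := hR (M + η) hB hArch (by rwa [show (M + η) / 2 = M / 2 + η / 2 by ring])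
      have := (hM (M + η) (by positivity)).1 hT
      linarith
    · -- every level below `2a` a rung forces `2a ≤ M`, hence `ε(a) ≥ ε(M/2) > 0`
      have hapos : 0 < a := by
        have h3 : 0 < Real.log 3 := Real.log_pos (by norm_num)
        have : Real.log 3 / 2 ≤ a := ‹_›
        linarith
      have h2a : 2 * a ≤ M := by
        by_contra hlt
        push Not at hlt
        have hBpos : 0 < (M + 2 * a) / 2 := by linarith
        have hT : WTrace ((M + 2 * a) / 2) := hbelow _ hBpos (by linarith)
        have := (hM _ hBpos).1 hT
        linarith
      rcases (show a ≤ M / 2 by linarith).lt_or_eq with hlt | heq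
      · exact hpos.trans (weilGroundEnergy_lt_of_lt (a := a) (A := M / 2) hapos hlt)
      · rwa [heq]
  · -- edge death: `CrystRegular` holds, `NoDegenerateEdge` fails at `a = M/2`
    have h0' : weilGroundEnergy (M / 2) = 0 := h0.symm
    refine Or.inr ⟨h0', fun B hB _ hεB => ?_, fun hE => ?_⟩
    · have hBpos : 0 < B := hlog2.trans_le hB
      refine (hM B hBpos).2 ?_
      by_contra hlt
      push Not at hlt
      have := weilGroundEnergy_lt_of_lt (a := M / 2) (A := B / 2) (by positivity) (by linarith)
      linarith
    · have h32 : Real.log 3 / 2 ≤ M / 2 := by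
        by_contra hlt
        push Not at hlt
        have := weilGroundEnergy_pos_of_lt_log_three_half' (a := M / 2) (by positivity) hlt
        linarith
      have hbelow : ∀ B : ℝ, 0 < B → B < 2 * (M / 2) → WTrace B := fun B hB hBlt =>
        (hM B hB).2 (by linarith)
      have := hE (M / 2) h32 hbelow
      linarith

end Summit.RiemannHypothesis.RiemannHypothesis.Theorems.SpectralTraceWindowStep

end
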